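import Summits.FinalStateConjecture.FinalStateConjecture.Theses.PhaseMixingCapture
import Summits.FinalStateConjecture.FinalStateConjecture.Theses.GlobalAttraction
import Summits.FinalStateConjecture.FinalStateConjecture.Theorems.PhaseMixingCaptureCaptureSufficesTameKickReduction

/-!
# Sketch — crux-strategist s1, crux `CaptureSufficesTame` (stmt-FinalStateConjecture-17270): the proposed SPLIT, typed in the
route file's own context (same namespace/opens as `Theses/PhaseMixingCapture.lean`), and its glue from the landed
`finalStateConjecture_of_unparkingKick` (p133919).

Children: `CensoredExteriorsSettle` (VERBATIM the body of GlobalAttraction.CensoredExteriorsSettle = stmt-17296),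
`SubextremalUpgrade` (VERBATIM GlobalAttraction.SubextremalUpgrade = stmt-17298), `UnparkingKick` (the relative third law along
censored tame curves, ∃-form = the registered `stub_unparkingKick` of line only-the-third-law v2/v4, fully qualified).
-/

set_option linter.dupNamespace false

namespace Summit.FinalStateConjecture.FinalStateConjecture.Theses.PhaseMixingCapture

open scoped BigOperators Topology Manifold Classical MeasureTheory ProbabilityTheory Matrix InnerProductSpace ComplexConjugate ContinuousMap
open Filter Set Function TopologicalSpace MeasureTheory

/-- child 1 (= stmt-FinalStateConjecture-17296 verbatim). -/
def CensoredExteriorsSettle : Prop :=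
  ∀ (X : Type) [TopologicalSpace X] [ChartedSpace Literature.Geometry.Lorentzian.E3 X] [IsManifold (𝓡 3) ((⊤ : ℕ∞) : WithTop ℕ∞) X] [T2Space X] [SecondCountableTopology X] [ConnectedSpace X], ∀ D ∈ Literature.Geometry.Lorentzian.admissibleVacuumData X, ∀ 𝒟 : Literature.Geometry.Lorentzian.VacuumCauchyDevelopment D, 𝒟.IsMaximal → Summit.FinalStateConjecture.HasCompleteNullInfinity 𝒟.toCauchyDevelopment → ∃ (O : Set 𝒟.carrier) (d : Literature.Geometry.Lorentzian.FinalStateDecomposition 𝒟.toSpacetime O 0), O = Summit.FinalStateConjecture.exteriorOf 𝒟.toCauchyDevelopment d.charted ∧ Summit.FinalStateConjecture.RaysStayInClosure 𝒟.toCauchyDevelopment O ∧ Summit.FinalStateConjecture.HasExhaustiveCharts d ∧ Summit.FinalStateConjecture.IsFutureOriented d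

/-- child 2 (= stmt-FinalStateConjecture-17298 verbatim). -/
def SubextremalUpgrade : Prop :=
  ∀ (X : Type) [TopologicalSpace X] [ChartedSpace Literature.Geometry.Lorentzian.E3 X] [IsManifold (𝓡 3) ((⊤ : ℕ∞) : WithTop ℕ∞) X] [T2Space X] [SecondCountableTopology X] [ConnectedSpace X], ∀ D ∈ Literature.Geometry.Lorentzian.admissibleVacuumData X, ∀ 𝒟 : Literature.Geometry.Lorentzian.VacuumCauchyDevelopment D, 𝒟.IsMaximal → Summit.FinalStateConjecture.HasCompleteNullInfinity 𝒟.toCauchyDevelopment → ∀ (O : Set 𝒟.carrier) (d₀ : Literature.Geometry.Lorentzian.FinalStateDecomposition 𝒟.toSpacetime O 0), O = Summit.FinalStateConjecture.exteriorOf 𝒟.toCauchyDevelopment d₀.charted → Summit.FinalStateConjecture.RaysStayInClosure 𝒟.toCauchyDevelopment O → Summit.FinalStateConjecture.HasExhaustiveCharts d₀ → Summit.FinalStateConjecture.IsFutureOriented d₀ → (∀ i, Literature.Geometry.Lorentzian.Kerr.IsSubextremal (d₀.mass i) (d₀.spin i)) → ∃ (O' : Set 𝒟.carrier) (d : Literature.Geometry.Lorentzian.FinalStateDecomposition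 𝒟.toSpacetime O' 2), (∀ i, Literature.Geometry.Lorentzian.Kerr.IsSubextremal (d.mass i) (d.spin i)) ∧ O' = Summit.FinalStateConjecture.exteriorOf 𝒟.toCauchyDevelopment d.charted ∧ Summit.FinalStateConjecture.RaysStayInClosure 𝒟.toCauchyDevelopment O' ∧ Summit.FinalStateConjecture.HasExhaustiveCharts d ∧ Summit.FinalStateConjecture.IsFutureOriented d

/-- child 3 (NEW item; = `stub_unparkingKick` of Cruxes/CaptureSufficesTame/Lines/only_the_third_law_is_generic.lean, fully qualified). -/
def UnparkingKick : Prop :=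
  ∀ (X : Type) [TopologicalSpace X] [ChartedSpace Literature.Geometry.Lorentzian.E3 X] [IsManifold (𝓡 3) ((⊤ : ℕ∞) : WithTop ℕ∞) X] [T2Space X] [SecondCountableTopology X] [ConnectedSpace X], ∀ (e : Literature.Geometry.Lorentzian.AFEnd X) (F : EuclideanSpace ℝ (Fin 1) → Literature.Geometry.Lorentzian.InitialDataSet (𝓡 3) X), Literature.Geometry.Lorentzian.InitialDataSet.IsTameDataFamily e 1 F → ((Literature.Geometry.Lorentzian.InitialDataSet.IsImmersedAtZero 1 F ∧ Function.Injective F) ∨ ∀ c, F c = F 0) → (∀ c, F c ∈ Literature.Geometry.Lorentzian.admissibleVacuumData X) → (∀ c ≠ 0, (∃ 𝒟 : Literature.Geometry.Lorentzian.VacuumCauchyDevelopment (F c), 𝒟.IsMaximal) ∧ ∀ 𝒟 : Literature.Geometry.Lorentzian.VacuumCauchyDevelopment (F c), 𝒟.IsMaximal → Summit.FinalStateConjecture.HasCompleteNullInfinity 𝒟.toCauchyDevelopment) → ¬ (((∃ 𝒟 : Literature.Geometry.Lorentzian.VacuumCauchyDevelopment (F 0), 𝒟.IsMaximal) ∧ ∀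 𝒟 : Literature.Geometry.Lorentzian.VacuumCauchyDevelopment (F 0), 𝒟.IsMaximal → Summit.FinalStateConjecture.HasCompleteNullInfinity 𝒟.toCauchyDevelopment) ∧ ∀ 𝒟 : Literature.Geometry.Lorentzian.VacuumCauchyDevelopment (F 0), 𝒟.IsMaximal → Summit.FinalStateConjecture.HasCompleteNullInfinity 𝒟.toCauchyDevelopment ∧ ((∃ (O : Set 𝒟.carrier) (d₀ : Literature.Geometry.Lorentzian.FinalStateDecomposition 𝒟.toSpacetime O 0), O = Summit.FinalStateConjecture.exteriorOf 𝒟.toCauchyDevelopment d₀.charted ∧ Summit.FinalStateConjecture.RaysStayInClosure 𝒟.toCauchyDevelopment O ∧ Summit.FinalStateConjecture.HasExhaustiveCharts d₀ ∧ Summit.FinalStateConjecture.IsFutureOriented d₀) → ∃ (O : Set 𝒟.carrier) (d : Literature.Geometry.Lorentzian.FinalStateDecomposition 𝒟.toSpacetime O 0), (∀ i, Literature.Geometry.Lorentzian.Kerr.IsSubextremal (d.mass i) (d.spin i)) ∧ O = Summit.FinalStateConjecture.exteriorOf 𝒟.toCauchyDevelopment d.charted ∧ Summit.FinalStateConjecture.RaysStayInClosure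 𝒟.toCauchyDevelopment O ∧ Summit.FinalStateConjecture.HasExhaustiveCharts d ∧ Summit.FinalStateConjecture.IsFutureOriented d)) → ∃ (e' : Literature.Geometry.Lorentzian.AFEnd X) (F' : EuclideanSpace ℝ (Fin 1) → Literature.Geometry.Lorentzian.InitialDataSet (𝓡 3) X), Literature.Geometry.Lorentzian.InitialDataSet.IsTameDataFamily e' 1 F' ∧ F' 0 = F 0 ∧ Function.Injective F' ∧ Literature.Geometry.Lorentzian.InitialDataSet.IsImmersedAtZero 1 F' ∧ (∀ c, F' c ∈ Literature.Geometry.Lorentzian.admissibleVacuumData X) ∧ ∃ ε₀ > (0 : ℝ), ∀ c : EuclideanSpace ℝ (Fin 1), c ≠ 0 → ‖c‖ < ε₀ → (((∃ 𝒟 : Literature.Geometry.Lorentzian.VacuumCauchyDevelopment (F' c), 𝒟.IsMaximal) ∧ ∀ 𝒟 : Literature.Geometry.Lorentzian.VacuumCauchyDevelopment (F' c), 𝒟.IsMaximal → Summit.FinalStateConjecture.HasCompleteNullInfinity 𝒟.toCauchyDevelopment) ∧ ∀ 𝒟 : Literature.Geometry.Lorentzian.VacuumCauchyDevelopment (F'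 c), 𝒟.IsMaximal → Summit.FinalStateConjecture.HasCompleteNullInfinity 𝒟.toCauchyDevelopment ∧ ((∃ (O : Set 𝒟.carrier) (d₀ : Literature.Geometry.Lorentzian.FinalStateDecomposition 𝒟.toSpacetime O 0), O = Summit.FinalStateConjecture.exteriorOf 𝒟.toCauchyDevelopment d₀.charted ∧ Summit.FinalStateConjecture.RaysStayInClosure 𝒟.toCauchyDevelopment O ∧ Summit.FinalStateConjecture.HasExhaustiveCharts d₀ ∧ Summit.FinalStateConjecture.IsFutureOriented d₀) → ∃ (O : Set 𝒟.carrier) (d : Literature.Geometry.Lorentzian.FinalStateDecomposition 𝒟.toSpacetime O 0), (∀ i, Literature.Geometry.Lorentzian.Kerr.IsSubextremal (d.mass i) (d.spin i)) ∧ O = Summit.FinalStateConjecture.exteriorOf 𝒟.toCauchyDevelopment d.charted ∧ Summit.FinalStateConjecture.RaysStayInClosure 𝒟.toCauchyDevelopment O ∧ Summit.FinalStateConjecture.HasExhaustiveCharts d ∧ Summit.FinalStateConjecture.IsFutureOriented d))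

/-- sanity: children 1 and 2 are the other route's decls VERBATIM (so the ledger dedupes them onto stmt-17296 / stmt-17298). -/
example : CensoredExteriorsSettle ↔ Summit.FinalStateConjecture.FinalStateConjecture.Theses.GlobalAttraction.CensoredExteriorsSettle :=
  Iff.rfl
example : SubextremalUpgrade ↔ Summit.FinalStateConjecture.FinalStateConjecture.Theses.GlobalAttraction.SubextremalUpgrade := Iff.rfl

/-- **The glue of the split, kernel-checked**: `CensoredExteriorsSettle → SubextremalUpgrade → UnparkingKick → CaptureSufficesTame`
from the landed Theses-free reduction `finalStateConjecture_of_unparkingKick : W → A → U → R → FinalStateConjecture` (p133919): the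
crux's first two hypotheses are introduced and dropped (idle as typed, Disproof §0), the third (`WeakCosmicCensorshipTame`) is `W`. -/
theorem captureSufficesTame_of_subs :
    CensoredExteriorsSettle → SubextremalUpgrade → UnparkingKick → CaptureSufficesTame :=
  fun hA hU hR _ _ hW ↦
    Summit.FinalStateConjecture.FinalStateConjecture.Theorems.PhaseMixingCaptureCaptureSufficesTame.finalStateConjecture_of_unparkingKick
      hW hA hU hR

#print axioms captureSufficesTame_of_subs

end Summit.FinalStateConjecture.FinalStateConjecture.Theses.PhaseMixingCapture
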